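import Summits.ValiantsHypothesis.ValiantsHypothesis.Theorems.RigidMinimalRepsOrbitsForceTorusAction

/-!
# `OrbitsForceTorus` — finitely many gauge orbits of doubly-minimal representations force
exact two-sided torus lifts

Route `route-ValiantsHypothesis-RigidMinimalReps`, item `stmt-ValiantsHypothesis-5115` (support):
`DoublyMinimalFinite → MinimalRepTorusSymmetric` (`orbitsForceTorus_proof`).

## The argument

Fix `n ≥ max n₀ 1` and `s = dc(per_n)`.  The normalised torus action
`(d, e) ⋆ A = D_{d,e} · A(x_{kl} ↦ d_k e_l x_{kl})` of `T = (ℂˣ)ⁿ × (ℂˣ)ⁿ`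
(`RigidMinimalRepsOrbitsForceTorusAction.lean`: `torusAct`) preserves the set `M` of *doubly-minimal*
representations (affine determinantal representations of `per_n` of size `s` minimising the total
coefficient rank `Σ_v rank A_v`), is a genuine action of the abelian group `T`, and commutes with the
gauge action `A ↦ P A Q` up to conjugating `P`.  By `DoublyMinimalFinite`, `M` meets at most `N`
gauge classes.  **Orbit argument** (`gauge_torusAct_of_finite`, for any `T`-stable `M` covered by
`N` classes): given `t ∈ T` pick `u ∈ T` with `u^{N!} = t` (`ℂ` is algebraically closed); among
`A, u ⋆ A, …, u^N ⋆ A` two are gauge-equivalent (pigeonhole), so `A ~ u^j ⋆ A` for some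
`1 ≤ j ≤ N` (cancel `u^a` by acting with its inverse), hence `A ~ u^{jm} ⋆ A` for all `m`, and
`jm = N!` gives `A ~ t ⋆ A` — the finite-index stabiliser of a class is everything because `T` is
divisible.  Unwinding, `A(t·x) = (D_t⁻¹ P) · A · Q` is an exact lift of `t`.  A doubly-minimal `A₀`
exists (`dc` is attained, `hasDetRepr_determinantalComplexity_holds`; then minimise the `ℕ`-valued
rank sum), it has positive size for `n ≥ 1`, and the elements of `GL(n²)` admitting exact lifts are
closed under the group operations (`lifts_one/mul/inv`), so `Subgroup.closure_induction` extends the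
lifts from the generators `diag(d) ⊗ diag(e)` to the generated subgroup.
-/

-- `Summit.<Summit>.<Problem>` repeats `ValiantsHypothesis` by the tree's layout convention (D-0017).
set_option linter.dupNamespace false

noncomputable section

namespace Summit.ValiantsHypothesis.ValiantsHypothesis.Theorems

open Literature.Computability.AlgebraicComplexity
open Literature.Computability.AlgebraicComplexity.LRPencil
open MvPolynomial Matrix
open scoped Kronecker

namespace RigidMinimalRepsOrbitsForceTorus

variable {n s : ℕ} (i₀ : Fin s)

/-- **The orbit argument.** Let `M` be a torus-stable set of `s × s` matrices covered by finitely
many gauge classes `{P · F_i · Q}`.  Then every `A ∈ M` is gauge-equivalent to each of its torus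
translates `(d,e) ⋆ A`: pigeonhole on the iterates of an `N!`-th root of `(d,e)`, then divisibility
(a finite-index subgroup of the divisible group `T` is all of `T`). -/
theorem gauge_torusAct_of_finite {M : Matrix (Fin s) (Fin s) (MvPolynomial (Fin n × Fin n) ℂ) → Prop}
    (hM : ∀ (d e : Fin n → ℂˣ) (A : Matrix (Fin s) (Fin s) (MvPolynomial (Fin n × Fin n) ℂ)),
      M A → M (torusAct i₀ d e A))
    {N : ℕ} (F : Fin N → Matrix (Fin s) (Fin s) (MvPolynomial (Fin n × Fin n) ℂ))
    (hF : ∀ A : Matrix (Fin s) (Fin s) (MvPolynomial (Fin n × Fin n) ℂ), M A →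
      ∃ (i : Fin N) (P Q : GL (Fin s) ℂ),
        A = (P : Matrix (Fin s) (Fin s) ℂ).map C * F i * (Q : Matrix (Fin s) (Fin s) ℂ).map C)
    {A : Matrix (Fin s) (Fin s) (MvPolynomial (Fin n × Fin n) ℂ)} (hA : M A) (d e : Fin n → ℂˣ) :
    ∃ P Q : GL (Fin s) ℂ, torusAct i₀ d e A =
      (P : Matrix (Fin s) (Fin s) ℂ).map C * A * (Q : Matrix (Fin s) (Fin s) ℂ).map C := by
  classical
  -- an `N!`-th root `(d', e')` of `(d, e)`
  obtain ⟨d', hd'⟩ := exists_pow_eq d (Nat.factorial_pos N)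
  obtain ⟨e', he'⟩ := exists_pow_eq e (Nat.factorial_pos N)
  -- all iterates stay in `M`
  have hB : ∀ j : ℕ, M (torusAct i₀ (d' ^ j) (e' ^ j) A) := fun j => hM _ _ _ hA
  -- the class index of an element of `M`
  choose idx Pm Qm hidx using hF
  -- pigeonhole among the first `N + 1` iterates
  obtain ⟨j₁, j₂, hne, heq⟩ := Fintype.exists_ne_map_eq_of_card_lt
    (fun j : Fin (N + 1) => idx _ (hB j)) (by simp)
  have heq' : idx _ (hB j₁) = idx _ (hB j₂) := heq
  -- two iterates in one class are gauge-equivalent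
  have hrel : ∃ P Q : GL (Fin s) ℂ, torusAct i₀ (d' ^ (j₂ : ℕ)) (e' ^ (j₂ : ℕ)) A =
      (P : Matrix (Fin s) (Fin s) ℂ).map C * torusAct i₀ (d' ^ (j₁ : ℕ)) (e' ^ (j₁ : ℕ)) A *
        (Q : Matrix (Fin s) (Fin s) ℂ).map C := by
    have h1 : ∃ P Q : GL (Fin s) ℂ, torusAct i₀ (d' ^ (j₁ : ℕ)) (e' ^ (j₁ : ℕ)) A =
        (P : Matrix (Fin s) (Fin s) ℂ).map C * F (idx _ (hB j₁)) * (Q : Matrix (Fin s) (Fin s) ℂ).map C :=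
      ⟨_, _, hidx _ (hB j₁)⟩
    have h2 : ∃ P Q : GL (Fin s) ℂ, torusAct i₀ (d' ^ (j₂ : ℕ)) (e' ^ (j₂ : ℕ)) A =
        (P : Matrix (Fin s) (Fin s) ℂ).map C * F (idx _ (hB j₂)) * (Q : Matrix (Fin s) (Fin s) ℂ).map C :=
      ⟨_, _, hidx _ (hB j₂)⟩
    rw [heq'] at h1
    exact gauge_trans (gauge_symm h1) h2
  -- hence `A ~ (d'^t, e'^t) ⋆ A` for some `0 < t ≤ N`
  obtain ⟨t, ht0, htN, hrelt⟩ : ∃ t : ℕ, 0 < t ∧ t ≤ N ∧ ∃ P Q : GL (Fin s) ℂ,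
      torusAct i₀ (d' ^ t) (e' ^ t) A =
        (P : Matrix (Fin s) (Fin s) ℂ).map C * A * (Q : Matrix (Fin s) (Fin s) ℂ).map C := by
    have hj₁ : (j₁ : ℕ) ≤ N := Nat.lt_succ_iff.1 j₁.isLt
    have hj₂ : (j₂ : ℕ) ≤ N := Nat.lt_succ_iff.1 j₂.isLt
    have hne' : (j₁ : ℕ) ≠ j₂ := fun h => hne (Fin.ext h)
    -- transport `u^a ⋆ A ~ u^b ⋆ A` back to `A ~ u^(b-a) ⋆ A` for `a < b` (act with `u^{-a}`)
    have key : ∀ a b : ℕ, a < b →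
        (∃ P Q : GL (Fin s) ℂ, torusAct i₀ (d' ^ b) (e' ^ b) A =
          (P : Matrix (Fin s) (Fin s) ℂ).map C * torusAct i₀ (d' ^ a) (e' ^ a) A *
            (Q : Matrix (Fin s) (Fin s) ℂ).map C) →
        ∃ P Q : GL (Fin s) ℂ, torusAct i₀ (d' ^ (b - a)) (e' ^ (b - a)) A =
          (P : Matrix (Fin s) (Fin s) ℂ).map C * A * (Q : Matrix (Fin s) (Fin s) ℂ).map C := by
      intro a b hab h
      have h' := gauge_torusAct i₀ (d' ^ a)⁻¹ (e' ^ a)⁻¹ h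
      rwa [torusAct_mul, torusAct_mul, inv_mul_cancel, inv_mul_cancel, torusAct_one,
        mul_comm (d' ^ a)⁻¹, mul_comm (e' ^ a)⁻¹, ← pow_sub d' hab.le, ← pow_sub e' hab.le] at h'
    rcases lt_or_gt_of_ne hne' with hlt | hlt
    · exact ⟨j₂ - j₁, Nat.sub_pos_of_lt hlt, (Nat.sub_le _ _).trans hj₂, key _ _ hlt hrel⟩
    · exact ⟨j₁ - j₂, Nat.sub_pos_of_lt hlt, (Nat.sub_le _ _).trans hj₁, key _ _ hlt (gauge_symm hrel)⟩
  -- and `A ~ (d'^{tm}, e'^{tm}) ⋆ A` for every `m`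
  have hmult : ∀ m : ℕ, ∃ P Q : GL (Fin s) ℂ, torusAct i₀ (d' ^ (t * m)) (e' ^ (t * m)) A =
      (P : Matrix (Fin s) (Fin s) ℂ).map C * A * (Q : Matrix (Fin s) (Fin s) ℂ).map C := by
    intro m
    induction m with
    | zero =>
      rw [mul_zero, pow_zero, pow_zero, torusAct_one]
      exact gauge_refl A
    | succ m ih =>
      have h := gauge_torusAct i₀ (d' ^ t) (e' ^ t) ih
      rw [torusAct_mul, ← pow_add, ← pow_add] at h
      have hexp : t + t * m = t * (m + 1) := by ring
      rw [hexp] at h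
      exact gauge_trans hrelt h
  -- `t ∣ N!`, and `(d'^{N!}, e'^{N!}) = (d, e)`
  obtain ⟨c, hc⟩ := Nat.dvd_factorial ht0 htN
  have h := hmult c
  rwa [← hc, hd', he'] at h

end RigidMinimalRepsOrbitsForceTorus

open RigidMinimalRepsOrbitsForceTorus
open Summit.ValiantsHypothesis.ValiantsHypothesis.Theses.RigidMinimalReps

/-- **`OrbitsForceTorus`** (route `RigidMinimalReps`, item `stmt-ValiantsHypothesis-5115`):
if, for all large `n`, the doubly-minimal affine determinantal representations of `per_n` (size
`dc(per_n)`, minimal total coefficient rank) are covered by finitely many `GL × GL` gauge orbits,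
then for all large `n` some representation of size `dc(per_n)` admits exact lifts of the whole
two-sided torus `x_{kl} ↦ d_k e_l x_{kl}`.  Proof: a doubly-minimal `A₀` exists; the normalised torus
action preserves the doubly-minimal locus and permutes its finitely many gauge classes; the torus is
divisible, so (pigeonhole on roots) every class is fixed, i.e. `A₀(t·x) = (D_t⁻¹ P) A₀ Q`; the liftable
elements are closed under the group operations, so the generated subgroup lifts. -/
theorem orbitsForceTorus_proof :
    Summit.ValiantsHypothesis.ValiantsHypothesis.Theses.RigidMinimalReps.OrbitsForceTorus := by
  unfold OrbitsForceTorus DoublyMinimalFinite MinimalRepTorusSymmetric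
  rintro ⟨n₀, hn₀⟩
  refine ⟨max n₀ 1, fun n hn => ?_⟩
  have hn₀' : n₀ ≤ n := le_of_max_le_left hn
  have hn1 : 1 ≤ n := le_of_max_le_right hn
  classical
  -- work at a fixed size `s = dc(per_n)` (generalised, to keep `dc` opaque)
  obtain ⟨s, hs⟩ : ∃ s : ℕ, determinantalComplexity (perPoly (Fin n) ℂ) = s := ⟨_, rfl⟩
  have hdc : HasDetRepr (perPoly (Fin n) ℂ) s :=
    hs ▸ hasDetRepr_determinantalComplexity_holds (perPoly (Fin n) ℂ)
  rw [hs]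
  -- the finite family of orbit representatives
  obtain ⟨N, F, hF⟩ := hn₀ n hn₀' s hs
  -- a doubly-minimal representation `A₀`: `dc` is attained, then minimise the rank sum over `ℕ`
  have hexr : ∃ r : ℕ, ∃ A : Matrix (Fin s) (Fin s) (MvPolynomial (Fin n × Fin n) ℂ),
      IsAffineDetRepr (perPoly (Fin n) ℂ) A ∧
        ∑ v : Fin n × Fin n, (A.map (coeff (Finsupp.single v 1))).rank = r := by
    obtain ⟨A, hA⟩ := hdc
    exact ⟨_, A, hA, rfl⟩
  obtain ⟨A₀, hA₀, hr⟩ := Nat.find_spec hexr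
  have hmin : ∀ A' : Matrix (Fin s) (Fin s) (MvPolynomial (Fin n × Fin n) ℂ),
      IsAffineDetRepr (perPoly (Fin n) ℂ) A' →
        ∑ v : Fin n × Fin n, (A₀.map (coeff (Finsupp.single v 1))).rank ≤
          ∑ v : Fin n × Fin n, (A'.map (coeff (Finsupp.single v 1))).rank := fun A' hA' => by
    rw [hr]
    exact Nat.find_min' hexr ⟨A', hA', rfl⟩
  have hs0 : 0 < s := pos_of_isAffineDetRepr hn1 hA₀
  obtain ⟨i₀⟩ : Nonempty (Fin s) := ⟨⟨0, hs0⟩⟩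
  -- the doubly-minimal locus `M` is torus-stable and covered by the `N` classes
  set M : Matrix (Fin s) (Fin s) (MvPolynomial (Fin n × Fin n) ℂ) → Prop := fun A =>
    IsAffineDetRepr (perPoly (Fin n) ℂ) A ∧
      ∀ A' : Matrix (Fin s) (Fin s) (MvPolynomial (Fin n × Fin n) ℂ),
        IsAffineDetRepr (perPoly (Fin n) ℂ) A' →
          ∑ v : Fin n × Fin n, (A.map (coeff (Finsupp.single v 1))).rank ≤
            ∑ v : Fin n × Fin n, (A'.map (coeff (Finsupp.single v 1))).rank
  have hM : ∀ (d e : Fin n → ℂˣ) (A : Matrix (Fin s) (Fin s) (MvPolynomial (Fin n × Fin n) ℂ)),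
      M A → M (torusAct i₀ d e A) := fun d e A h =>
    ⟨isAffineDetRepr_torusAct i₀ d e h.1, fun A' hA' =>
      (rankSum_torusAct_le i₀ d e h.1.1).trans (h.2 A' hA')⟩
  have hF' : ∀ A : Matrix (Fin s) (Fin s) (MvPolynomial (Fin n × Fin n) ℂ), M A →
      ∃ (i : Fin N) (P Q : GL (Fin s) ℂ),
        A = (P : Matrix (Fin s) (Fin s) ℂ).map C * F i * (Q : Matrix (Fin s) (Fin s) ℂ).map C :=
    fun A h => hF A h.1 h.2
  have hA₀M : M A₀ := ⟨hA₀, hmin⟩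
  -- `A₀` is torus-equivariant: the liftable elements are closed under the group operations
  refine ⟨A₀, isEquivariantDetRepr_iff_exists_mul_mul.2 ⟨hA₀, fun γ hγ => ?_⟩⟩
  induction hγ using Subgroup.closure_induction with
  | one => exact lifts_one A₀
  | mul x y _ _ hx hy => exact lifts_mul hx hy
  | inv x _ hx => exact lifts_inv hx
  | mem γ hγ =>
    obtain ⟨d, e, hd, he, hγe⟩ := hγ
    -- the generator `γ = diag(d) ⊗ diag(e)` as a torus element with unit entries
    obtain ⟨du, hdu⟩ : ∃ du : Fin n → ℂˣ, (fun i => (du i : ℂ)) = d :=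
      ⟨fun i => Units.mk0 (d i) (hd i), rfl⟩
    obtain ⟨eu, heu⟩ : ∃ eu : Fin n → ℂˣ, (fun j => (eu j : ℂ)) = e :=
      ⟨fun j => Units.mk0 (e j) (he j), rfl⟩
    subst hdu heu
    have hγT : γ = torusGL du eu := Units.ext (by rw [hγe, coe_torusGL'])
    obtain ⟨P, Q, hPQ⟩ := gauge_torusAct_of_finite i₀ hM F hF' hA₀M du eu
    refine ⟨(normGL i₀ du eu)⁻¹ * P, Q, ?_⟩
    rw [hγT]
    calc Matrix.linSubstEntries (torusGL du eu) A₀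
        = (((normGL i₀ du eu)⁻¹ : GL (Fin s) ℂ) : Matrix (Fin s) (Fin s) ℂ).map C *
            torusAct i₀ du eu A₀ := (inv_map_C_mul_cancel_left (normGL i₀ du eu) _).symm
      _ = _ := by
        rw [hPQ]
        simp only [Units.val_mul, Matrix.map_mul, Matrix.mul_assoc]

end Summit.ValiantsHypothesis.ValiantsHypothesis.Theorems

end
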